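import Literature.AlgebraicGeometry.DeterminantalHypersurfaces.ChanIltenFanoNonemptyProofs
import Literature.Computability.AlgebraicComplexity.StandardFamilies
import Literature.LinearAlgebra.Matrix.PermanentLaplace
import HarnessLib

/-!
# `PR₁(per_n) = n`: the permanent lies in no ideal generated by fewer than `n` linear forms
# (Chan–Ilten 2015, Proposition 2.6 at `r = m = n`) — the `k = 1` case of rank laws for two-factor
# decompositions `per_n = Σ_i p_i q_i`

Topic `Literature/AlgebraicGeometry/DeterminantalHypersurfaces`; consumer-side corollaries of the sibling files
`ChanIltenFanoNonempty.lean` (the typed fact `ChanIlten.proposition26`, M. Chan, N. Ilten, *Fano schemes of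
determinants and permanents*, Algebra & Number Theory 9 (2015) 629–679, arXiv:1312.2577, Proposition 2.6, held
text `paper:arxiv-1312.2577` p0007 L28–35: "The Fano schemes `F_k(D^r_{m,n})` and `F_k(P^r_{m,n})` are nonempty
if and only if `k < (r-1)n`") and `ChanIltenFanoNonemptyProofs.lean` (its proof; in particular the
infinite-field degeneration theorem `ChanIlten.lt_of_wsum_vanish`: a `(k+1)`-dimensional subspace of `m × n`
matrices, `m ≤ n`, on which every `r × r` `ε`-weighted permutation sum vanishes has `k < (r-1)·n`).

The case `r = m = n` reads: a linear subspace of `n × n` matrices on which `per_n` (resp. `det_n`) vanishes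
identically has dimension at most `(n-1)·n = n² - n`.  Dually, in the vocabulary of the tree's standard families
(`Literature.Computability.AlgebraicComplexity.perPoly` / `detPoly`, the generic permanent / determinant in the
`n²` variables `X_{ij}`), over any INFINITE field `K` (no hypothesis on the characteristic):

* `ChanIlten.le_of_perPoly_eq_sum_linear_mul` — if `per_n = Σ_{i<w} ℓ_i · q_i` with every `ℓ_i` a linear
  form (`IsHomogeneous 1`) and arbitrary cofactors `q_i`, then `n ≤ w`: the common zero set of the `ℓ_i` is a
  subspace of dimension `≥ n² - w` on which `per_n` vanishes;
* `ChanIlten.le_of_perPoly_mem_span` — the same as ideal membership: `per_n ∈ (ℓ_1, …, ℓ_w) ⇒ n ≤ w`;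
* `ChanIlten.le_of_perPoly_eq_sum_C_mul_X_mul` — coefficient form (the `ℓ_i` given by coefficient vectors);
* `ChanIlten.le_of_detPoly_eq_sum_linear_mul` — the determinantal twin (Dieudonné's theorem; the
  `D^n_{n,n}` half of Proposition 2.6);
* `ChanIlten.perPoly_succ_eq_sum_X_mul_permanent`, `ChanIlten.exists_perPoly_succ_eq_sum_linear_mul` — the easy
  converse: the Laplace expansion of the permanent along a row (Minc, *Permanents*, §1.2; tree:
  `Matrix.permanent_eq_sum_row_zero`) writes `per_{n+1}` as `n + 1` products (linear form) × (form of degree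
  `n`), so `w = n + 1` is attained and the least such `w` is exactly the matrix size.

In the language of two-factor decompositions `per_n = Σ_{i<w} p_i q_i` with `deg p_i = k` this is the known
case `k = 1` ("`PR₁(per_n) = n`", the degree-one product rank / slice rank of the permanent): every `(1, n-1)`
decomposition has width `≥ n = C(n,1)`.  Honest framing: a `k = 1` calibration point, proved from published
literature; it says nothing about `k ≥ 2`, nothing here bears on `VP ≠ VNP` (NOT proved), and no summit
statement is proved in this file.

[cite: ChanIlten2015, Proposition 2.6 (case `r = m = n`)]; Laplace expansion of the permanent
[cite: Minc1978, §1.2].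
-/

noncomputable section

namespace Literature.AlgebraicGeometry.DeterminantalHypersurfaces.ChanIlten

open Matrix Finset MvPolynomial Literature.Computability.AlgebraicComplexity

variable {K : Type*} [Field K]

/-! ### Plumbing: linear forms, their common kernel, sub-permanents along self-embeddings -/

/-- A linear form is the sum of its coefficients times the variables. [folklore] -/
private theorem eq_sum_C_mul_X_of_isHomogeneous_one {σ : Type*} [Fintype σ] {p : MvPolynomial σ K}
    (hp : p.IsHomogeneous 1) : p = ∑ s, C (coeff (Finsupp.single s 1) p) * X s := by
  classical
  ext d
  simp only [coeff_sum, coeff_C_mul, coeff_X, mul_ite, mul_one, mul_zero]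
  by_cases hd : Finsupp.degree d = 1
  · obtain ⟨z, rfl⟩ : d ∈ Set.range fun a : σ => Finsupp.single a 1 := by
      rw [Finsupp.range_single_one]
      exact hd
    rw [Finset.sum_eq_single z]
    · rw [if_pos rfl]
    · intro s _ hs
      exact if_neg fun h => hs (Finsupp.single_left_injective one_ne_zero h)
    · exact fun h => absurd (Finset.mem_univ z) h
  · rw [hp.coeff_eq_zero hd]
    symm
    refine Finset.sum_eq_zero fun s _ => if_neg ?_
    rintro rfl
    exact hd (by rw [Finsupp.degree_single])

/-- The common kernel of `w` linear forms `M ↦ Σ_v a i v · M_v` on `n × n` matrices has dimension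
`≥ n² - w` (rank–nullity). [folklore] -/
private theorem exists_ker_of_linear {n w : ℕ} (a : Fin w → Fin n × Fin n → K) :
    ∃ W : Submodule K (Matrix (Fin n) (Fin n) K), n * n ≤ Module.finrank K W + w ∧
      ∀ M ∈ W, ∀ i, ∑ v, a i v * M v.1 v.2 = 0 := by
  classical
  let Φ : Matrix (Fin n) (Fin n) K →ₗ[K] (Fin w → K) :=
    { toFun := fun M i => ∑ v, a i v * M v.1 v.2
      map_add' := fun M N => by
        ext i
        simp [mul_add, Finset.sum_add_distrib]
      map_smul' := fun x M => by
        ext i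
        simp [Finset.mul_sum, mul_left_comm] }
  refine ⟨LinearMap.ker Φ, ?_, fun M hM i => congr_fun (LinearMap.mem_ker.mp hM) i⟩
  have hrn := LinearMap.finrank_range_add_finrank_ker Φ
  have hrange : Module.finrank K (LinearMap.range Φ) ≤ w :=
    (Submodule.finrank_le _).trans (by simp)
  have hmat : Module.finrank K (Matrix (Fin n) (Fin n) K) = n * n := by
    simp [Module.finrank_matrix]
  omega

/-- On square matrices, sub-permanents along self-embeddings are the permanent. [folklore] -/
private theorem permanent_submatrix_embedding_self {n : ℕ} (M : Matrix (Fin n) (Fin n) K)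
    (ρ γ : Fin n ↪ Fin n) : (M.submatrix ρ γ).permanent = M.permanent := by
  have h : M.submatrix ρ γ =
      (M.submatrix (Equiv.ofBijective ρ ρ.injective.bijective_of_finite) id).submatrix id
        (Equiv.ofBijective γ γ.injective.bijective_of_finite) := rfl
  rw [h, Matrix.permanent_permute_rows, Matrix.permanent_permute_cols]

/-- On square matrices, minors along self-embeddings vanish with the determinant. [folklore] -/
private theorem det_submatrix_embedding_self_eq_zero {n : ℕ} {M : Matrix (Fin n) (Fin n) K}
    (hM : M.det = 0) (ρ γ : Fin n ↪ Fin n) : (M.submatrix ρ γ).det = 0 := by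
  have h : M.submatrix ρ γ =
      (M.submatrix (Equiv.ofBijective ρ ρ.injective.bijective_of_finite) id).submatrix id
        (Equiv.ofBijective γ γ.injective.bijective_of_finite) := rfl
  rw [h, Matrix.det_permute', Matrix.det_permute, hM, mul_zero, mul_zero]

/-- **Proposition 2.6 at `r = m = n`, dimension form** (from the sibling file's `lt_of_wsum_vanish`): over an
infinite field, a linear subspace of `n × n` matrices on which the `ε`-weighted `n × n` permutation sums along
all row/column self-embeddings vanish (`ε 1 ≠ 0`) has dimension `≤ (n-1)·n`.
[cite: ChanIlten2015, Proposition 2.6 (case `r = m = n`)] -/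
private theorem finrank_le_of_wsum_vanish [Infinite K] {n : ℕ} (ε : Equiv.Perm (Fin n) → ℤ)
    (hε : (ε 1 : K) ≠ 0) (W : Submodule K (Matrix (Fin n) (Fin n) K))
    (hvan : ∀ M ∈ W, ∀ (ρ γ : Fin n ↪ Fin n),
      (∑ σ : Equiv.Perm (Fin n), (ε σ : K) * ∏ i, M (ρ (σ i)) (γ i)) = 0) :
    Module.finrank K W ≤ (n - 1) * n := by
  rcases Nat.eq_zero_or_pos (Module.finrank K W) with h0 | hpos
  · rw [h0]
    exact Nat.zero_le _
  · have hW : Module.finrank K W = (Module.finrank K W - 1) + 1 := by omega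
    have h := lt_of_wsum_vanish le_rfl ε hε W hW hvan
    omega

/-- **Permanents, `r = m = n`:** over an infinite field, a linear subspace of `n × n` matrices on which `per_n`
vanishes identically has dimension `≤ (n-1)·n`. [cite: ChanIlten2015, Proposition 2.6 (case `r = m = n`)] -/
theorem finrank_le_of_permanent_eq_zero [Infinite K] {n : ℕ} (W : Submodule K (Matrix (Fin n) (Fin n) K))
    (hW : ∀ M ∈ W, M.permanent = 0) : Module.finrank K W ≤ (n - 1) * n := by
  refine finrank_le_of_wsum_vanish (fun _ => 1) (by simp) W fun M hM ρ γ => ?_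
  have h : (M.submatrix ρ γ).permanent = 0 := by rw [permanent_submatrix_embedding_self, hW M hM]
  simp only [Matrix.permanent, Matrix.submatrix_apply] at h
  simpa only [Int.cast_one, one_mul] using h

/-- **Determinants, `r = m = n` (Dieudonné):** over an infinite field, a linear subspace of singular `n × n`
matrices has dimension `≤ (n-1)·n`. [cite: ChanIlten2015, Proposition 2.6 (case `r = m = n`)] -/
theorem finrank_le_of_det_eq_zero [Infinite K] {n : ℕ} (W : Submodule K (Matrix (Fin n) (Fin n) K))
    (hW : ∀ M ∈ W, M.det = 0) : Module.finrank K W ≤ (n - 1) * n := by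
  refine finrank_le_of_wsum_vanish (fun σ => ((Equiv.Perm.sign σ : ℤˣ) : ℤ)) (by simp) W
    fun M hM ρ γ => ?_
  have h := det_submatrix_embedding_self_eq_zero (hW M hM) ρ γ
  rw [Matrix.det_apply'] at h
  simpa only [Matrix.submatrix_apply] using h

/-! ### `PR₁(per_n) ≥ n` -/

/-- **`PR₁(per_n) ≥ n`, coefficient form.**  Over an infinite field: if
`per_n = Σ_{i<w} (Σ_v a_{iv} X_v) · q_i` for scalars `a_{iv}` and arbitrary polynomials `q_i`, then `n ≤ w`:
the common zero set `W` of the `w` linear forms has `dim W ≥ n² - w`, `per_n` vanishes on `W`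
(`eval_perPoly`), and `finrank_le_of_permanent_eq_zero` gives `dim W ≤ (n-1)·n`.
[cite: ChanIlten2015, Proposition 2.6 (case `r = m = n`)] -/
theorem le_of_perPoly_eq_sum_C_mul_X_mul [Infinite K] {n w : ℕ} (a : Fin w → Fin n × Fin n → K)
    (q : Fin w → MvPolynomial (Fin n × Fin n) K)
    (h : perPoly (Fin n) K = ∑ i, (∑ v, C (a i v) * X v) * q i) : n ≤ w := by
  classical
  obtain ⟨W, hdim, hW⟩ := exists_ker_of_linear a
  have hper : ∀ M ∈ W, M.permanent = 0 := by
    intro M hM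
    have h1 := congrArg (MvPolynomial.eval fun v : Fin n × Fin n => M v.1 v.2) h
    rw [eval_perPoly] at h1
    simp only [map_sum, map_mul, eval_C, eval_X, hW M hM, zero_mul, Finset.sum_const_zero] at h1
    exact h1
  have hfin : Module.finrank K W ≤ (n - 1) * n := finrank_le_of_permanent_eq_zero W hper
  have h3 : (n - 1) * n + n = n * n := by
    cases n with
    | zero => simp
    | succ n => rw [Nat.add_sub_cancel]; ring
  omega

/-- **`PR₁(per_n) ≥ n`** (Chan–Ilten 2.6 at `r = m = n`; the `k = 1` case of rank laws for two-factor
decompositions `per_n = Σ p_i q_i`, `deg p_i = k`): over an infinite field, if `per_n = Σ_{i<w} ℓ_i q_i` with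
every `ℓ_i` a LINEAR form (homogeneous of degree `1`; the `q_i` arbitrary), then `n ≤ w`.  The Laplace
expansion along a row (`exists_perPoly_succ_eq_sum_linear_mul`) shows that `w = n` is attained.
[cite: ChanIlten2015, Proposition 2.6 (case `r = m = n`)] -/
theorem le_of_perPoly_eq_sum_linear_mul [Infinite K] {n w : ℕ}
    (ℓ q : Fin w → MvPolynomial (Fin n × Fin n) K) (hℓ : ∀ i, (ℓ i).IsHomogeneous 1)
    (h : perPoly (Fin n) K = ∑ i, ℓ i * q i) : n ≤ w := by
  refine le_of_perPoly_eq_sum_C_mul_X_mul (fun i v => coeff (Finsupp.single v 1) (ℓ i)) q ?_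
  rw [h]
  exact Finset.sum_congr rfl fun i _ => by rw [← eq_sum_C_mul_X_of_isHomogeneous_one (hℓ i)]

/-- **`per_n ∉ (ℓ_1, …, ℓ_w)` for `w < n` linear forms** (ideal-membership form of
`le_of_perPoly_eq_sum_linear_mul`). [cite: ChanIlten2015, Proposition 2.6 (case `r = m = n`)] -/
theorem le_of_perPoly_mem_span [Infinite K] {n w : ℕ} (ℓ : Fin w → MvPolynomial (Fin n × Fin n) K)
    (hℓ : ∀ i, (ℓ i).IsHomogeneous 1) (h : perPoly (Fin n) K ∈ Ideal.span (Set.range ℓ)) : n ≤ w := by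
  obtain ⟨c, hc⟩ := Ideal.mem_span_range_iff_exists_fun.mp h
  refine le_of_perPoly_eq_sum_linear_mul ℓ c hℓ ?_
  rw [← hc]
  exact Finset.sum_congr rfl fun i _ => mul_comm _ _

/-- **`PR₁(det_n) ≥ n`** (Dieudonné; Chan–Ilten 2.6 for `D^n_{n,n}`): over an infinite field, if
`det_n = Σ_{i<w} ℓ_i q_i` with linear forms `ℓ_i`, then `n ≤ w`.
[cite: ChanIlten2015, Proposition 2.6 (case `r = m = n`)] -/
theorem le_of_detPoly_eq_sum_linear_mul [Infinite K] {n w : ℕ}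
    (ℓ q : Fin w → MvPolynomial (Fin n × Fin n) K) (hℓ : ∀ i, (ℓ i).IsHomogeneous 1)
    (h : detPoly (Fin n) K = ∑ i, ℓ i * q i) : n ≤ w := by
  classical
  obtain ⟨W, hdim, hW⟩ := exists_ker_of_linear fun i v => coeff (Finsupp.single v 1) (ℓ i)
  have hdet : ∀ M ∈ W, M.det = 0 := by
    intro M hM
    have h1 := congrArg (MvPolynomial.eval fun v : Fin n × Fin n => M v.1 v.2) h
    rw [eval_detPoly] at h1
    have h2 : MvPolynomial.eval (fun v : Fin n × Fin n => M v.1 v.2) (∑ i, ℓ i * q i) = 0 := by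
      rw [map_sum]
      refine Finset.sum_eq_zero fun i _ => ?_
      rw [map_mul, eq_sum_C_mul_X_of_isHomogeneous_one (hℓ i)]
      simp only [map_sum, map_mul, eval_C, eval_X, hW M hM, zero_mul]
    rw [h2] at h1
    exact h1
  have hfin : Module.finrank K W ≤ (n - 1) * n := finrank_le_of_det_eq_zero W hdet
  have h3 : (n - 1) * n + n = n * n := by
    cases n with
    | zero => simp
    | succ n => rw [Nat.add_sub_cancel]; ring
  omega

/-! ### `PR₁(per_n) ≤ n`: the Laplace expansion along a row -/

/-- **`PR₁(per_n) ≤ n`, the easy half** ("`w = n` is attained"): the Laplace expansion along row `0`,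
`per_{n+1} = Σ_j X_{0j} · per(minor_{0j})` (tree: `Matrix.permanent_eq_sum_row_zero`), writes `per_{n+1}`
as `n + 1` products (linear form) × (sub-permanent) (Minc, *Permanents*, §1.2: Laplace expansion of the
permanent by a row). [cite: Minc1978, §1.2 (Laplace expansion)] -/
theorem perPoly_succ_eq_sum_X_mul_permanent (n : ℕ) :
    perPoly (Fin (n + 1)) K = ∑ j : Fin (n + 1), X ((0 : Fin (n + 1)), j) *
      ((Matrix.mvPolynomialX (Fin (n + 1)) (Fin (n + 1)) K).submatrix Fin.succ j.succAbove).permanent := by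
  unfold perPoly
  rw [Matrix.permanent_eq_sum_row_zero]
  rfl

/-- **`PR₁(per_{n+1}) = n + 1`, upper half as a witness:** `per_{n+1} = Σ_{j ≤ n} ℓ_j q_j` with `ℓ_j = X_{0j}`
linear and `q_j` (the sub-permanent of the minor `(0, j)`) homogeneous of degree `n`; with
`le_of_perPoly_eq_sum_linear_mul` the least number of products (linear form) × (polynomial) summing to
`per_{n+1}` is exactly `n + 1` over any infinite field. (`per_0 = 1` is the empty case: no such sum.)
[cite: Minc1978, §1.2 (Laplace expansion)] -/
theorem exists_perPoly_succ_eq_sum_linear_mul (n : ℕ) :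
    ∃ ℓ q : Fin (n + 1) → MvPolynomial (Fin (n + 1) × Fin (n + 1)) K,
      (∀ j, (ℓ j).IsHomogeneous 1) ∧ (∀ j, (q j).IsHomogeneous n) ∧
        perPoly (Fin (n + 1)) K = ∑ j, ℓ j * q j := by
  refine ⟨fun j => X ((0 : Fin (n + 1)), j),
    fun j => ((Matrix.mvPolynomialX (Fin (n + 1)) (Fin (n + 1)) K).submatrix
      Fin.succ j.succAbove).permanent,
    fun j => isHomogeneous_X _ _, fun j => ?_, perPoly_succ_eq_sum_X_mul_permanent n⟩
  unfold Matrix.permanent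
  refine IsHomogeneous.sum _ _ _ fun σ _ => ?_
  have h := IsHomogeneous.prod (Finset.univ : Finset (Fin n))
    (fun i => ((Matrix.mvPolynomialX (Fin (n + 1)) (Fin (n + 1)) K).submatrix
      Fin.succ j.succAbove) (σ i) i) (fun _ => 1) fun i _ => isHomogeneous_X _ _
  simpa using h

end Literature.AlgebraicGeometry.DeterminantalHypersurfaces.ChanIlten

end
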